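/-
COR-CM (cell pub-hodgecm2, stage 2 of the Hodge ladder) — count-neutral KERNEL COMBINATORICS «dicyclic twist over a CYCLIC group: the number of blocks
in closed form» (seat prover-pub-hodgecm2-b23-g43-0, binder prover b23, gen 43; claim DICYCLIC-EVEN, HOME/INBOX.md l.10881; blanket `Census/DicyclicTwist*`).
Theorems only, on top of `Census/DicyclicTwistBlockCountEven.lean` (this lane) and Mathlib's `IsAddCyclic.card_addOrderOf_eq_totient` used BY NAME;
`decide` only on closed numerals (`Nat.divisors` / `Nat.totient` of `8` and `10`), no certificate, no named fact, no `sorry`; `Interfaces.lean` (C1),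
every E term, B01, `Transposition/*`, `PortJoin/*` untouched.
HONEST FRAMING: `HC_CM` is NOT proved, here or anywhere in the tree; nothing here is a period, a count of record or a headline.
T5: n/a-class (hypothesis binders: the dicyclic datum, `c * c = 1`); checker: self, 2026-08-23.
-/
import Summits.HodgeConjecture.CorCM.Census.DicyclicTwistBlockCountEven

/-!
# The dicyclic twist over `ℤ/m`: `β · 4m = Σ_{d ∣ m} φ(d) · (1 + [d even]) · 4^{m/d}`

Along a dicyclic datum over the CYCLIC group `A = ℤ/m` (`G = Dic(ℤ/2 × ℤ/m, c) ≅ ℤ/m ⋊ ℤ/4` for `m` even resp. `Dic_m`-like for `m` odd, order `4m`)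
the block count of `Census/DicyclicTwistBlockCountEven.lean` (`β · 4|A| = Σ_{s ∈ A} (1 + [ord s even]) · 4^{|A|/ord s}`) is summed over the
order statistics of `ℤ/m` (`φ(d)` elements of order `d` for every `d ∣ m`, Mathlib `IsAddCyclic.card_addOrderOf_eq_totient`):

  **`β(G, c) · 4m = Σ_{d ∣ m} φ(d) · (1 + [d even]) · 4^{m/d}`** (`card_block_mul_four_mul_eq_sum_divisors`),

so that, with the dicyclic law `μ = β − 1` for every `A` (`Census/DicyclicTwistLaw.lean`), every cyclic row of the dicyclic column is a closed numeral:
`m = 4`: `β = 19`; `m = 6`: `β = 178`; **`m = 8`: `β = 2067`** (`card_block_eq_of_zmod_eight`; `G = ℤ/8 ⋊ ℤ/4` of order `32`); **`m = 10`: `β = 26268`**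
(`card_block_eq_of_zmod_ten`; order `40`).  All [folklore].

## References
* [Milne1999] J. S. Milne, Lefschetz motives and the Tate conjecture, Compositio Math. 117 (1999), Prop. 2.1, p. 54.
-/

namespace Summit.HodgeConjecture.CorCM.Census.DicyclicTwist

open Finset
open Summit.HodgeConjecture.CorCM.Prior.AllgGroup.RfwfAllgGroup
open Summit.HodgeConjecture.CorCM.Census.BlockParity

noncomputable section

variable {G : Type*} [Group G] [Fintype G] [DecidableEq G] {c : G}

/-- **`β · 4m = Σ_{d ∣ m} φ(d) · (1 + [d even]) · 4^{m/d}`** along a dicyclic datum over `ℤ/m`. [folklore] -/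
theorem card_block_mul_four_mul_eq_sum_divisors {m : ℕ} [NeZero m] (D : Datum G c (ZMod m)) (hc2 : c * c = 1) :
    Fintype.card (BlockParity.Block c) * (4 * m) = ∑ d ∈ m.divisors, d.totient * ((if Even d then 2 else 1) * 4 ^ (m / d)) := by
  classical
  have h := card_block_mul_four_card_eq_sum D hc2
  rw [ZMod.card] at h
  have hmaps : ∀ s ∈ (Finset.univ : Finset (ZMod m)), addOrderOf s ∈ m.divisors := fun s _ =>
    Nat.mem_divisors.mpr ⟨by simpa only [ZMod.card] using (addOrderOf_dvd_card (x := s)), NeZero.ne m⟩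
  rw [h, ← Finset.sum_fiberwise_of_maps_to' hmaps (fun d => (if Even d then 2 else 1) * 4 ^ (m / d))]
  refine Finset.sum_congr rfl fun d hd => ?_
  have hdvd : d ∣ Fintype.card (ZMod m) := by rw [ZMod.card]; exact Nat.dvd_of_mem_divisors hd
  rw [Finset.sum_const, smul_eq_mul, IsAddCyclic.card_addOrderOf_eq_totient hdvd]

/-- **`m = 8`: `β = 2067`** (`G = Dic(ℤ/2 × ℤ/8, c) = ℤ/8 ⋊ ℤ/4` of order `32`; `β · 32 = 4⁸ + 2·4⁴ + 2·2·4² + 4·2·4 = 66144`). [folklore] -/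
theorem card_block_eq_of_zmod_eight (D : Datum G c (ZMod 8)) (hc2 : c * c = 1) : Fintype.card (BlockParity.Block c) = 2067 := by
  have h := card_block_mul_four_mul_eq_sum_divisors D hc2
  have hdiv : Nat.divisors 8 = {1, 2, 4, 8} := by decide
  have ht1 : Nat.totient 1 = 1 := Nat.totient_one
  have ht2 : Nat.totient 2 = 1 := by decide
  have ht4 : Nat.totient 4 = 2 := by decide
  have ht8 : Nat.totient 8 = 4 := by decide
  rw [hdiv, Finset.sum_insert (by decide), Finset.sum_insert (by decide), Finset.sum_pair (by decide), ht1, ht2, ht4, ht8] at h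
  norm_num at h
  omega

/-- **`m = 10`: `β = 26268`** (`G = Dic(ℤ/2 × ℤ/10, c) ≅ Dic₅ × ℤ/2` of order `40`, `c = x²`; `β · 40 = 4¹⁰ + 2·4⁵ + 4·4² + 4·2·4 = 1050720`).
[folklore] -/
theorem card_block_eq_of_zmod_ten (D : Datum G c (ZMod 10)) (hc2 : c * c = 1) : Fintype.card (BlockParity.Block c) = 26268 := by
  have h := card_block_mul_four_mul_eq_sum_divisors D hc2
  have hdiv : Nat.divisors 10 = {1, 2, 5, 10} := by decide
  have ht1 : Nat.totient 1 = 1 := Nat.totient_one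
  have ht2 : Nat.totient 2 = 1 := by decide
  have ht5 : Nat.totient 5 = 4 := by decide
  have ht10 : Nat.totient 10 = 4 := by decide
  rw [hdiv, Finset.sum_insert (by decide), Finset.sum_insert (by decide), Finset.sum_pair (by decide), ht1, ht2, ht5, ht10] at h
  norm_num at h
  omega

end

end Summit.HodgeConjecture.CorCM.Census.DicyclicTwist
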